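import Summits.AtomisticToContinuum.Crystallization.Theses.ChessboardParticlePlanes
import Summits.AtomisticToContinuum.Crystallization.Theorems.ChargedEnergyGap.Negative.Periodisation
import Summits.AtomisticToContinuum.Crystallization.Theorems.PhononStability.Negative.Mirror
import Literature.MathematicalPhysics.StatisticalMechanics.LennardJonesClusters
import Literature.Geometry.MetricGeometry.PointedGromovHausdorff

/-!
# Route `ChessboardParticlePlanes`, item stmt-AtomisticToContinuum-6713 `LaminarPeriodisation`

`LjLaminarWindows → LayerConfinedCompetitors` (glue, bookkeeping).

Proof.  Lennard-Jones ground states exist for every `N` (`LennardJonesGroundStatesExist_holds`),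
so the hypothesis applies to an actual sequence of ground states.  Given `ε > 0` put
`η = min (1/60) (ε / 250000)` and call the hypothesis with `(η, ε/2)`; at `L = max L₀ 0` it yields,
for some `N`, a window `W = {j : dist (x j) (x i) ≤ L}` (non-empty: `i ∈ W`), a linear isometry `A`
and a `3/4`-separated set of heights `T`.  Rotate the window, `y m = A (x (emb m) - x i)`
(`emb : Fin #W ↪o Fin N` enumerates `W`; distances are unchanged), and snap the third coordinate of
each `y m` to its plane `t m ∈ T` (`|y m 2 - t m| ≤ η`): `z m = y m + (t m - y m 2) • e₂`.  Then
`dist (z m) (y m) ≤ η`, so `z` is `2/3`-separated (`7/10 - 2η ≥ 2/3`), and every `z m` has height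
in `T`.  Periodise `z` with the cubic lattice of period `c = 2Σ‖z m‖ + 2` (the tree's
`ChargedEnergyGapNegative.periodise`): points of different copies are `≥ 2` apart and heights of
different vertical copies are `≥ 2` apart, so the periodic configuration is `2/3`-separated and
layer-confined with heights pairwise `≥ 3/4` apart; its energy per particle is `≤ E(z)/#W`
(`energyPerParticle_periodise_le`: cross-copy terms are `≤ 0`).  Finally
`2E(z) ≤ 2E(y) + 250000 η · #W` by the mean value theorem (`|V'(t)| ≤ 19 t⁻⁶` on `[2/3, ∞)`,
`V'` from `PhononStabilityNegative.hasDerivAt_lennardJones`) and the shell sum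
`sum_inv_pow_six_le`, while `2E(y)` is the window energy `≤ 2(e* + ε/2) #W`.
-/

noncomputable section

namespace Summit.AtomisticToContinuum.Crystallization.Theorems

namespace ChessboardLaminarPeriodisation

open scoped BigOperators
open Literature.MathematicalPhysics.StatisticalMechanics
open Literature.Barriers.AtomisticToContinuum (cubicLattice)
open ChargedEnergyGapNegative (E3 Dsum Dsum_nonneg norm_le_Dsum period period_pos periodUnit
  val_periodUnit periodise motif_periodise two_le_dist_of_mem_points
  exists_int_coord_of_mem_cubicLattice energyPerParticle_periodise_le)
open PhononStabilityNegative (hasDerivAt_lennardJones)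

/-! ## The Lennard-Jones potential is Lipschitz on `[2/3, ∞)` with a summable constant -/

/-- `|V_LJ'(t)| ≤ 19 t⁻⁶` for `t ≥ 2/3` (`|V'(t)| ≤ t⁻¹³ + t⁻⁷ = (t⁻⁷ + t⁻¹) t⁻⁶` and
`(3/2)⁷ + 3/2 < 19`). [folklore] -/
theorem abs_deriv_lennardJones_le' {t : ℝ} (ht : (2 : ℝ) / 3 ≤ t) :
    |deriv lennardJones t| ≤ 19 * t⁻¹ ^ 6 := by
  have ht0 : 0 < t := by linarith
  rw [(hasDerivAt_lennardJones ht0.ne').deriv]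
  have hi : t⁻¹ ≤ 3 / 2 := by
    rw [inv_le_comm₀ ht0 (by norm_num)]
    linarith
  have hi0 : 0 ≤ t⁻¹ := inv_nonneg.2 ht0.le
  have h7 : t⁻¹ ^ 7 ≤ (3 / 2 : ℝ) ^ 7 := pow_le_pow_left₀ hi0 hi 7
  have h6 : 0 ≤ t⁻¹ ^ 6 := by positivity
  have e13 : t⁻¹ ^ 13 = t⁻¹ ^ 7 * t⁻¹ ^ 6 := by ring
  have e7 : t⁻¹ ^ 7 = t⁻¹ * t⁻¹ ^ 6 := by ring
  have hK : (3 / 2 : ℝ) ^ 7 + 3 / 2 ≤ 19 := by norm_num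
  refine abs_le.2 ⟨?_, ?_⟩
  · rw [e13, e7]
    nlinarith [mul_le_mul_of_nonneg_right h7 h6, mul_le_mul_of_nonneg_right hi h6,
      mul_nonneg hi0 h6, mul_nonneg (pow_nonneg hi0 7) h6]
  · rw [e13, e7]
    nlinarith [mul_le_mul_of_nonneg_right h7 h6, mul_le_mul_of_nonneg_right hi h6,
      mul_nonneg hi0 h6, mul_nonneg (pow_nonneg hi0 7) h6]

/-- Mean value bound: for `a, b ≥ 2/3`,
`|V_LJ(a) - V_LJ(b)| ≤ 19 (a⁻⁶ + b⁻⁶) |a - b|`. [folklore] -/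
theorem abs_lennardJones_sub_le {a b : ℝ} (ha : (2 : ℝ) / 3 ≤ a) (hb : (2 : ℝ) / 3 ≤ b) :
    |lennardJones a - lennardJones b| ≤ 19 * (a⁻¹ ^ 6 + b⁻¹ ^ 6) * |a - b| := by
  set m := min a b with hm
  have hm23 : (2 : ℝ) / 3 ≤ m := le_min ha hb
  have hm0 : 0 < m := by linarith
  have hdiff : ∀ x ∈ Set.Ici m, DifferentiableAt ℝ lennardJones x := fun x hx =>
    (hasDerivAt_lennardJones (by linarith [Set.mem_Ici.1 hx] : 0 < x).ne').differentiableAt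
  have hbound : ∀ x ∈ Set.Ici m, ‖deriv lennardJones x‖ ≤ 19 * m⁻¹ ^ 6 := fun x hx => by
    have hx' : m ≤ x := Set.mem_Ici.1 hx
    rw [Real.norm_eq_abs]
    refine (abs_deriv_lennardJones_le' (hm23.trans hx')).trans ?_
    have : x⁻¹ ^ 6 ≤ m⁻¹ ^ 6 :=
      pow_le_pow_left₀ (inv_nonneg.2 (hm0.le.trans hx')) (inv_anti₀ hm0 hx') 6
    linarith
  have hmvt := (convex_Ici m).norm_image_sub_le_of_norm_deriv_le hdiff hbound
    (Set.mem_Ici.2 (min_le_right a b)) (Set.mem_Ici.2 (min_le_left a b))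
  rw [Real.norm_eq_abs, Real.norm_eq_abs] at hmvt
  have hmin : m⁻¹ ^ 6 ≤ a⁻¹ ^ 6 + b⁻¹ ^ 6 := by
    rcases min_choice a b with h | h
    · rw [hm, h]; linarith [pow_nonneg (inv_nonneg.2 (by linarith : (0 : ℝ) ≤ b)) 6]
    · rw [hm, h]; linarith [pow_nonneg (inv_nonneg.2 (by linarith : (0 : ℝ) ≤ a)) 6]
  calc |lennardJones a - lennardJones b| ≤ 19 * m⁻¹ ^ 6 * |a - b| := hmvt
    _ ≤ 19 * (a⁻¹ ^ 6 + b⁻¹ ^ 6) * |a - b| := by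
        have := abs_nonneg (a - b)
        nlinarith

/-- **Per-site perturbation bound.** If `y` and `z` are `2/3`-separated finite configurations of
`ℝ³` with `dist (z m) (y m) ≤ η` for all `m`, then for every site `m`
`∑_{k ≠ m} |V_LJ(|z m - z k|) - V_LJ(|y m - y k|)| ≤ 250000 η`
(mean value bound plus the shell sum `∑_{k ≠ m} |· - ·|⁻⁶ ≤ 250 (3/2)⁶` for each configuration).
[folklore] -/
theorem sum_abs_lennardJones_sub_le {n : ℕ} (y z : Fin n → E3) {η : ℝ} (hη : 0 ≤ η)
    (hy : ∀ k l, k ≠ l → (2 : ℝ) / 3 ≤ dist (y k) (y l))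
    (hz : ∀ k l, k ≠ l → (2 : ℝ) / 3 ≤ dist (z k) (z l))
    (hclose : ∀ m, dist (z m) (y m) ≤ η) (m : Fin n) :
    ∑ k ∈ Finset.univ.erase m,
      |lennardJones (dist (z m) (z k)) - lennardJones (dist (y m) (y k))| ≤ 250000 * η := by
  have h23 : (0 : ℝ) < 2 / 3 := by norm_num
  have hSz := sum_inv_pow_six_le z h23 hz m
  have hSy := sum_inv_pow_six_le y h23 hy m
  have hterm : ∀ k ∈ Finset.univ.erase m,
      |lennardJones (dist (z m) (z k)) - lennardJones (dist (y m) (y k))| ≤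
        (19 * (2 * η)) * ((dist (z m) (z k))⁻¹ ^ 6 + (dist (y m) (y k))⁻¹ ^ 6) := by
    intro k hk
    have hkm : m ≠ k := (Finset.ne_of_mem_erase hk).symm
    have ha := hz m k hkm
    have hb := hy m k hkm
    have hd : |dist (z m) (z k) - dist (y m) (y k)| ≤ 2 * η := by
      have := Literature.Geometry.MetricGeometry.abs_dist_sub_dist_le (z m) (z k) (y m) (y k)
      linarith [hclose m, hclose k]
    have h := abs_lennardJones_sub_le ha hb
    have hpos : 0 ≤ 19 * ((dist (z m) (z k))⁻¹ ^ 6 + (dist (y m) (y k))⁻¹ ^ 6) := by positivity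
    calc |lennardJones (dist (z m) (z k)) - lennardJones (dist (y m) (y k))|
        ≤ 19 * ((dist (z m) (z k))⁻¹ ^ 6 + (dist (y m) (y k))⁻¹ ^ 6) *
            |dist (z m) (z k) - dist (y m) (y k)| := h
      _ ≤ 19 * ((dist (z m) (z k))⁻¹ ^ 6 + (dist (y m) (y k))⁻¹ ^ 6) * (2 * η) :=
            mul_le_mul_of_nonneg_left hd hpos
      _ = (19 * (2 * η)) * ((dist (z m) (z k))⁻¹ ^ 6 + (dist (y m) (y k))⁻¹ ^ 6) := by ring
  calc ∑ k ∈ Finset.univ.erase m,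
        |lennardJones (dist (z m) (z k)) - lennardJones (dist (y m) (y k))|
      ≤ ∑ k ∈ Finset.univ.erase m,
          (19 * (2 * η)) * ((dist (z m) (z k))⁻¹ ^ 6 + (dist (y m) (y k))⁻¹ ^ 6) :=
        Finset.sum_le_sum hterm
    _ = (19 * (2 * η)) * (∑ k ∈ Finset.univ.erase m, (dist (z m) (z k))⁻¹ ^ 6 +
          ∑ k ∈ Finset.univ.erase m, (dist (y m) (y k))⁻¹ ^ 6) := by
        rw [← Finset.mul_sum, Finset.sum_add_distrib]
    _ ≤ (19 * (2 * η)) * (250 * (2 / 3 : ℝ)⁻¹ ^ 6 + 250 * (2 / 3 : ℝ)⁻¹ ^ 6) :=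
        mul_le_mul_of_nonneg_left (add_le_add hSz hSy) (by positivity)
    _ ≤ 250000 * η := by norm_num; nlinarith

/-- Double sums with a window indicator are double sums over the window (the diagonal terms
vanish). [folklore] -/
theorem sum_sum_ite_window {N : ℕ} (p : Fin N → Prop) [DecidablePred p] (f : Fin N → Fin N → ℝ)
    (hf : ∀ j, f j j = 0) :
    (∑ j, ∑ k, if j ≠ k ∧ p j ∧ p k then f j k else 0) =
      ∑ j ∈ Finset.univ.filter p, ∑ k ∈ Finset.univ.filter p, f j k := by
  rw [Finset.sum_filter]
  refine Finset.sum_congr rfl fun j _ => ?_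
  rw [Finset.sum_filter]
  by_cases hj : p j
  · rw [if_pos hj]
    refine Finset.sum_congr rfl fun k _ => ?_
    by_cases hjk : j = k
    · subst hjk
      simp [hf]
    · simp [hjk, hj]
  · rw [if_neg hj]
    exact Finset.sum_eq_zero fun k _ => by simp [hj]

/-! ## Geometry of the cubic periodisation -/

section Periodise

variable {n : ℕ} {z : Fin n → E3} (hn : 0 < n)

/-- The periodisation of a `2/3`-separated configuration (cubic period `2Σ‖z m‖ + 2`) is
`2/3`-separated: two points of one copy are `≥ 2/3` apart, points of different copies `≥ 2`.
[folklore] -/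
theorem periodise_separated (hz : ∀ k l, k ≠ l → (2 : ℝ) / 3 ≤ dist (z k) (z l)) :
    ∀ p ∈ (periodise z (periodUnit z) le_rfl hn).points,
      ∀ q ∈ (periodise z (periodUnit z) le_rfl hn).points, p ≠ q → (2 : ℝ) / 3 ≤ dist p q := by
  set P := periodise z (periodUnit z) le_rfl hn with hP
  intro p hp q hq hpq
  obtain ⟨p0, hp0, g, hg, rfl⟩ := hp
  rw [hP, motif_periodise] at hp0
  obtain ⟨m, -, rfl⟩ := Finset.mem_image.1 hp0
  have hq' : q - g ∈ P.points := by
    have := P.add_mem_points hq (P.lattice.neg_mem hg)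
    simpa [sub_eq_add_neg] using this
  have hdist : dist (z m + g) q = dist (z m) (q - g) := by
    rw [dist_eq_norm, dist_eq_norm]
    congr 1
    abel
  rw [hdist]
  by_cases hex : ∃ k, q - g = z k
  · obtain ⟨k, hk⟩ := hex
    rw [hk]
    refine hz m k ?_
    rintro rfl
    apply hpq
    rw [← hk]
    abel
  · push Not at hex
    have h2 := two_le_dist_of_mem_points z (periodUnit z) le_rfl hn m hq' hex
    linarith

/-- If all heights `z m 2` lie in a `3/4`-separated set `T`, then any two distinct heights of
points of the periodisation differ by `≥ 3/4`: within one vertical copy they are heights of `T`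
shifted by the same amount, across vertical copies they differ by `≥ c - 2Σ‖z m‖ = 2`.
[folklore] -/
theorem periodise_heights {T : Set ℝ} (hT : ∀ t ∈ T, ∀ t' ∈ T, t ≠ t' → (3 : ℝ) / 4 ≤ |t - t'|)
    (hzT : ∀ m, z m 2 ∈ T) :
    ∀ p ∈ (periodise z (periodUnit z) le_rfl hn).points,
      ∀ q ∈ (periodise z (periodUnit z) le_rfl hn).points,
        p 2 ≠ q 2 → (3 : ℝ) / 4 ≤ |p 2 - q 2| := by
  set P := periodise z (periodUnit z) le_rfl hn with hP
  intro p hp q hq hpq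
  obtain ⟨p0, hp0, g, hg, rfl⟩ := hp
  obtain ⟨q0, hq0, g', hg', rfl⟩ := hq
  rw [hP, motif_periodise] at hp0 hq0
  obtain ⟨m, -, rfl⟩ := Finset.mem_image.1 hp0
  obtain ⟨k, -, rfl⟩ := Finset.mem_image.1 hq0
  obtain ⟨a, ha⟩ := exists_int_coord_of_mem_cubicLattice (periodUnit z) hg 2
  obtain ⟨b, hb⟩ := exists_int_coord_of_mem_cubicLattice (periodUnit z) hg' 2
  rw [val_periodUnit] at ha hb
  simp only [PiLp.add_apply] at hpq ⊢
  rw [ha, hb] at hpq ⊢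
  by_cases hab : a = b
  · subst hab
    have hne : z m 2 ≠ z k 2 := fun h => hpq (by rw [h])
    have h34 := hT _ (hzT m) _ (hzT k) hne
    calc (3 : ℝ) / 4 ≤ |z m 2 - z k 2| := h34
      _ = |z m 2 + period z * a - (z k 2 + period z * a)| := by ring_nf
  · have h1 : (1 : ℝ) ≤ |(a : ℝ) - b| := by
      rw [← Int.cast_sub, ← Int.cast_abs]
      exact_mod_cast Int.one_le_abs (sub_ne_zero.2 hab)
    have hzm : |z m 2| ≤ Dsum z :=
      le_trans (by simpa using PiLp.norm_apply_le (z m) 2) (norm_le_Dsum z m)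
    have hzk : |z k 2| ≤ Dsum z :=
      le_trans (by simpa using PiLp.norm_apply_le (z k) 2) (norm_le_Dsum z k)
    have hper : period z = 2 * Dsum z + 2 := rfl
    have hc0 := period_pos z
    have key : period z ≤ |period z * ((a : ℝ) - b)| := by
      rw [abs_mul, abs_of_pos hc0]
      nlinarith
    have tri : |period z * ((a : ℝ) - b)| ≤
        |z m 2 + period z * a - (z k 2 + period z * b)| + |z m 2| + |z k 2| := by
      have e : period z * ((a : ℝ) - b) =
          (z m 2 + period z * a - (z k 2 + period z * b)) - z m 2 + z k 2 := by ring
      rw [e]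
      calc |z m 2 + period z * a - (z k 2 + period z * b) - z m 2 + z k 2|
          ≤ |z m 2 + period z * a - (z k 2 + period z * b) - z m 2| + |z k 2| := abs_add_le _ _
        _ ≤ |z m 2 + period z * a - (z k 2 + period z * b)| + |z m 2| + |z k 2| := by
            linarith [abs_sub (z m 2 + period z * a - (z k 2 + period z * b)) (z m 2)]
    linarith [Dsum_nonneg z]

end Periodise

end ChessboardLaminarPeriodisation

open ChessboardLaminarPeriodisation in
open Literature.MathematicalPhysics.StatisticalMechanics in
open ChargedEnergyGapNegative (E3 periodUnit periodise energyPerParticle_periodise_le) in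
/-- **Item stmt-AtomisticToContinuum-6713** (`LaminarPeriodisation`, route `ChessboardParticlePlanes`):
`LjLaminarWindows → LayerConfinedCompetitors` — laminar low-energy windows of Lennard-Jones ground
states, snapped onto their planes and periodised with a large cubic period, are layer-confined
`2/3`-separated periodic competitors within `ε` of the periodic infimum. [folklore] -/
theorem laminarPeriodisation_proof :
    Summit.AtomisticToContinuum.Crystallization.Theses.ChessboardParticlePlanes.LaminarPeriodisation := by
  unfold Summit.AtomisticToContinuum.Crystallization.Theses.ChessboardParticlePlanes.LaminarPeriodisation
    Summit.AtomisticToContinuum.Crystallization.Theses.ChessboardParticlePlanes.LjLaminarWindows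
    Summit.AtomisticToContinuum.Crystallization.Theses.ChessboardParticlePlanes.LayerConfinedCompetitors
  intro hLam ε hε
  -- a sequence of ground states
  choose x hx using LennardJonesGroundStatesExist_holds
  -- parameters
  set e : ℝ := ⨅ Q : PeriodicConfiguration 3, Q.energyPerParticle lennardJones with he
  set η : ℝ := min (1 / 60) (ε / 250000) with hη
  have hη0 : 0 < η := lt_min (by norm_num) (by positivity)
  have hη60 : η ≤ 1 / 60 := min_le_left _ _
  have hηε : 250000 * η ≤ ε := by
    have : η ≤ ε / 250000 := min_le_right _ _
    linarith
  obtain ⟨L₀, hL₀⟩ := hLam x hx η (ε / 2) hη0 (half_pos hε)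
  obtain ⟨N, i, A, T, hT, hsep, hlam, hE⟩ := (hL₀ (max L₀ 0) (le_max_left _ _)).exists
  set L : ℝ := max L₀ 0 with hL
  have hL0 : 0 ≤ L := le_max_right _ _
  -- the window and its enumeration
  set W : Finset (Fin N) := Finset.univ.filter (fun j => dist (x N j) (x N i) ≤ L) with hW
  have hiW : i ∈ W := by simp [hW, hL0]
  obtain ⟨n, hn_def⟩ : ∃ n : ℕ, W.card = n := ⟨_, rfl⟩
  have hn : 0 < n := hn_def ▸ Finset.card_pos.2 ⟨i, hiW⟩
  have hnR : (0 : ℝ) < n := by exact_mod_cast hn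
  obtain ⟨emb, hmap, hemb⟩ : ∃ emb : Fin n ↪o Fin N,
      Finset.univ.map emb.toEmbedding = W ∧ ∀ m, emb m ∈ W :=
    ⟨W.orderEmbOfFin hn_def, Finset.map_orderEmbOfFin_univ W hn_def, W.orderEmbOfFin_mem hn_def⟩
  have hembL : ∀ m, dist (x N (emb m)) (x N i) ≤ L := fun m => (Finset.mem_filter.1 (hemb m)).2
  -- the rotated window
  set y : Fin n → E3 := fun m => A (x N (emb m) - x N i) with hy
  have hdist_y : ∀ m k, dist (y m) (y k) = dist (x N (emb m)) (x N (emb k)) := fun m k => by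
    simp only [hy, LinearIsometry.dist_map, dist_sub_right]
  have hysep : ∀ k l, k ≠ l → (7 : ℝ) / 10 ≤ dist (y k) (y l) := fun k l hkl => by
    rw [hdist_y]
    exact hsep _ _ (fun h => hkl (emb.injective h)) (hembL k) (hembL l)
  have hysep' : ∀ k l, k ≠ l → (2 : ℝ) / 3 ≤ dist (y k) (y l) := fun k l hkl =>
    le_trans (by norm_num) (hysep k l hkl)
  -- the planes
  have hplane : ∀ m, ∃ t ∈ T, |y m 2 - t| ≤ η := fun m => hlam (emb m) (hembL m)
  choose t htT hty using hplane
  -- the snapped window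
  set z : Fin n → E3 := fun m => y m + (t m - y m 2) • EuclideanSpace.single (2 : Fin 3) (1 : ℝ)
    with hz
  have hz2 : ∀ m, z m 2 = t m := fun m => by
    simp [hz]
  have hzy : ∀ m, dist (z m) (y m) ≤ η := fun m => by
    rw [dist_eq_norm]
    simp only [hz, add_sub_cancel_left, norm_smul, PiLp.norm_single, norm_one, mul_one,
      Real.norm_eq_abs]
    rw [abs_sub_comm]
    exact hty m
  have hzsep : ∀ k l, k ≠ l → (2 : ℝ) / 3 ≤ dist (z k) (z l) := fun k l hkl => by
    have h1 := hysep k l hkl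
    have h2 := Literature.Geometry.MetricGeometry.abs_dist_sub_dist_le (z k) (z l) (y k) (y l)
    have h3 := (abs_le.1 h2).1
    linarith [hzy k, hzy l]
  have hzinj : Function.Injective z := fun k l hkl => by
    by_contra hne
    have := hzsep k l hne
    rw [hkl, dist_self] at this
    norm_num at this
  -- the periodic competitor
  refine ⟨periodise z (periodUnit z) le_rfl hn, periodise_separated hn hzsep,
    periodise_heights hn hT (fun m => by rw [hz2]; exact htT m), ?_⟩
  -- its energy
  have hV0 : lennardJones 0 = 0 := by norm_num [lennardJones]
  refine (energyPerParticle_periodise_le hzinj (periodUnit z) le_rfl hn).trans ?_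
  rw [div_le_iff₀ hnR]
  -- the window energy is `2 E(y)`
  have hcard : (Nat.card {j : Fin N // dist (x N j) (x N i) ≤ L} : ℝ) = n := by
    rw [Nat.card_eq_fintype_card, Fintype.card_subtype, ← hn_def]
  have hLHS : (∑ j, ∑ k, if j ≠ k ∧ dist (x N j) (x N i) ≤ L ∧ dist (x N k) (x N i) ≤ L then
      lennardJones (dist (x N j) (x N k)) else 0) = 2 * interactionEnergy lennardJones y := by
    rw [sum_sum_ite_window (fun j => dist (x N j) (x N i) ≤ L)
      (fun j k => lennardJones (dist (x N j) (x N k))) (fun j => by rw [dist_self, hV0])]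
    rw [← hW, ← hmap, sum_sum_map_eq_two_mul_interactionEnergy lennardJones hV0 (x N) emb.toEmbedding]
    congr 1
    unfold interactionEnergy
    refine Finset.sum_congr rfl fun m _ => Finset.sum_congr rfl fun k _ => ?_
    rw [hdist_y]
    rfl
  have hEy : 2 * interactionEnergy lennardJones y ≤ 2 * (e + ε / 2) * n := by
    rw [← hLHS, ← hcard]
    exact hE
  -- perturbation: `2 E(z) ≤ 2 E(y) + 250000 η n`
  have hpert : 2 * interactionEnergy lennardJones z ≤
      2 * interactionEnergy lennardJones y + n * (250000 * η) := by
    rw [two_mul_interactionEnergy_eq_sum_sum lennardJones hV0 z,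
      two_mul_interactionEnergy_eq_sum_sum lennardJones hV0 y]
    have hsite : ∀ m, ∑ k, lennardJones (dist (z m) (z k)) ≤
        ∑ k, lennardJones (dist (y m) (y k)) + 250000 * η := fun m => by
      rw [← Finset.add_sum_erase _ _ (Finset.mem_univ m),
        ← Finset.add_sum_erase _ _ (Finset.mem_univ m), dist_self, dist_self]
      have h := sum_abs_lennardJones_sub_le y z hη0.le hysep' hzsep hzy m
      have h2 : ∑ k ∈ Finset.univ.erase m, lennardJones (dist (z m) (z k)) -
          ∑ k ∈ Finset.univ.erase m, lennardJones (dist (y m) (y k)) ≤ 250000 * η := by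
        rw [← Finset.sum_sub_distrib]
        exact (Finset.sum_le_sum fun k _ => le_abs_self _).trans h
      linarith
    calc ∑ m, ∑ k, lennardJones (dist (z m) (z k))
        ≤ ∑ m, (∑ k, lennardJones (dist (y m) (y k)) + 250000 * η) :=
          Finset.sum_le_sum fun m _ => hsite m
      _ = ∑ m, ∑ k, lennardJones (dist (y m) (y k)) + n * (250000 * η) := by
          rw [Finset.sum_add_distrib, Finset.sum_const, Finset.card_univ, Fintype.card_fin,
            nsmul_eq_mul]
  have hnε : (n : ℝ) * (250000 * η) ≤ n * ε := mul_le_mul_of_nonneg_left hηε hnR.le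
  nlinarith

end Summit.AtomisticToContinuum.Crystallization.Theorems
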